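import Summits.BirchSwinnertonDyer.BirchSwinnertonDyer.Theorems.TameQuarticManinParityTprimeHeegnerUpperOfManinUnitSigmaMonoCarrierRows
import Summits.BirchSwinnertonDyer.BirchSwinnertonDyer.Theorems.TameQuarticManinParityTprimeHeegnerUpperOfManinUnitSigmaOntoMonoCarrier
import HarnessLib

/-!
# Crux X₄ `TprimeHeegnerUpperOfManinUnit` (stmt-BirchSwinnertonDyer-23738; TQMP r4 / TQS r303), line `rows_of_manin_unit` v2
# (3c59fc8b80b3), research stub Σ `stub_sigmaIrreducibleOptimalRows`: THE EXACT RESIDUAL OF Σ after the carrier-blind Jetchev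
# reading — Σ VERBATIM ⟸ {20165's S2′, Gross 3.7 (2), Poitou–Tate, GZ86 III (3.1) image-free} + Σ⁺, the INCREMENT on the depths
# `m_max(E) < s′ ≤ ord₃ ∏_ℓ c_ℓ(E)` (non-vacuous only on the rows with ≥ 2 Tamagawa-`3` carriers)

HONEST FRAMING. Theorems only; helper file (`--supports stmt-BirchSwinnertonDyer-23738 --as helper`, leafhand `leafhand-bsd-tamequarticmaninpa-5`
g0, 2026-08-31); no definition, no named fact, no `sorry`; CONDITIONAL on every displayed input; nothing booked, no stub closed BY NAME, no
item closed, BSD proved for no curve. Fourth file of this seat after `…SigmaCarrierBlind` (S2♭: the divisibility reading at ANY carrier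
`q ∣ N_E`, p827050), `…SigmaMonoCarrierRows` (Σ on all mono-carrier rows; Jetchev's Thm. 1.4 `M_∞ ≥ m_max` in McCallum currency, p827407)
and `…SigmaOntoMonoCarrier` (the onto face is print, p827485).

* §1 `sigmaIrreducibleOptimalRows_of_increment_of_prop52IrredP_of_namedFacts` — Σ's statement VERBATIM as the conclusion, from S2′ + the
  three named facts + the displayed INCREMENT Σ⁺ := Σ's own binders with the depth clause sharpened to «every prime `q ∣ N_E` has
  `ord₃ c_q(E) < s′`» ∧ «`s′ ≤ ord₃ ∏_ℓ c_ℓ(E)`». Case split per depth: `s′ ≤ ord₃ c_q` for some `q ∣ N_E` ⟹ S2♭ on the frame; else Σ⁺.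
* §2 `sigmaIrreducibleOptimalRows_iff_increment_of_prop52IrredP_of_namedFacts` — Σ ⟺ Σ⁺ modulo {S2′, three facts}.
* §3 `sigmaOntoRows_of_increment_of_threePrintFacts` — on the rows with `ρ̄₃` ONTO (v1's r₁): Σ ⟸ three PRINT facts {Poitou–Tate, Gross §6 `E⁰`,
  Gross 3.7 (2)} + the onto-increment, NO reading stub (the swap end form of `…SigmaOntoMonoCarrier`, p827485, pays every depth `≤ ord₃ c_q`).
WHAT THIS SAYS. Σ⁺ is the ONE remaining research statement of Σ, in the kernel's own vocabulary (a candidate v3 stub text for the route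
pen; this hand registers nothing): vacuous whenever `ord₃ ∏ c_ℓ = max_q ord₃ c_q` (≤ 1 Tamagawa-`3` carrier), and on the rows with ≥ 2
carriers exactly the surplus of the refined Kolyvagin `≥`-half `M_∞ ≥ ord₃ ∏ c_ℓ` (Jetchev Conj. 1.3; p826193) over Jetchev's Thm. 1.4
(`M_∞ ≥ m_max`, `…SigmaMonoCarrierRows` §1b). Jetchev's §6 method does not pay it: at a minimal core vertex with carriers `q₁, …, q_s` the
`−ε` dual Selmer module of the stringent structure is `⊕_i ℤ/3^{t_i}` (Poitou–Tate), one Kolyvagin prime `ℓ` reads a CYCLIC image of it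
(`H¹_f(K_λ, E[3^m])^{±}` has rank one), i.e. `max t_i`, and at `cℓ` the same duality computation returns `⊕_i ℤ/3^{t_i}` again.
References: [cite: Jetchev2008, Thm. 1.4 (p. 812), Conj. 1.3, §6 Lemma 6.1, Thm. 6.3] [cite: McCallumLMS1991, §5 Prop. 5.2 (p. 304)]
[cite: GrossLMS1991, Prop. 3.7 (2), §6 p. 245] [cite: GrossZagier1986, III (3.1)] [cite: MilneADT2006, Ch. I, Thm. 4.10(b)].
presearch (D-0021): `lean search 'increment|mMax|multiCarrier'` → SOED J‴ 25898 `WildSigmaDivisibilityAtThreeMultiCarrier` (Gss/wild sibling, statement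
item, no proof) only; [corpus:arxiv-math_0703431 §6] caps at `m_max`; [corpus:arxiv-2312.09301] BCGS Thm. 2 proves `M_∞ = ord_p ∏ c_q` for `p > 3`
good ordinary onto split only; galaxy «refined Kolyvagin|Kolyvagin conjecture» → W. Zhang 2014 / BCGS. Pure composition of tree theorems.
-/

-- D-0017: single-problem summit, so `Summit.BirchSwinnertonDyer.BirchSwinnertonDyer.…` repeats a namespace BY DESIGN.
set_option linter.dupNamespace false
set_option autoImplicit false

noncomputable section

open scoped Classical NumberField

open WeierstrassCurve IsDedekindDomain NumberField Literature Literature.NumberTheory.EllipticCurves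
  Literature.NumberTheory.EllipticCurves.ModularForms
  Literature.NumberTheory.EllipticCurves.Rank1Residual
  Literature.NumberTheory.EllipticCurves.Rank1Residual.Typed
  Literature.NumberTheory.GaloisCohomology
  Summit.BirchSwinnertonDyer.Rank1Residual
  Summit.BirchSwinnertonDyer.Rank1Residual.Additive
  Summit.BirchSwinnertonDyer.Rank1Residual.X11b
  Summit.BirchSwinnertonDyer.Rank1Residual.X11b.Three
  Summit.BirchSwinnertonDyer.BirchSwinnertonDyer.Theses
  Summit.BirchSwinnertonDyer.BirchSwinnertonDyer.Theorems

namespace Summit.BirchSwinnertonDyer.BirchSwinnertonDyer.Theorems.TprimeHeegnerUpperOfManinUnit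

/-! ## §1 Σ VERBATIM ⟸ reading inputs + the INCREMENT Σ⁺ beyond `m_max` -/

/-- **THE EXACT RESIDUAL OF Σ AFTER THE CARRIER-BLIND READING.** The registered research stub Σ = `stub_sigmaIrreducibleOptimalRows`
(crux 23738, line `rows_of_manin_unit` v2) — statement VERBATIM as the conclusion — follows from crux 20165's registered reading S2′
(`h52I`, McCallum Prop. 5.2 irreducible, VERBATIM), the three named Literature facts `h37` (Gross 1991 Prop. 3.7 (2)), `hPT`
(Poitou–Tate, ∀ K), `hF1` ([GZ86 III (3.1)] image-free), AND the displayed INCREMENT `hIncr` = Σ⁺: Σ's own binders with the depth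
clause sharpened to «`m_max(E) < s′ ≤ ord₃ ∏_ℓ c_ℓ(E)`» (`∀ q ∣ N_E` prime, `ord₃ c_q(E) < s′`). Σ⁺ is VACUOUS on every row with
`ord₃ ∏ c_ℓ = max_q ord₃ c_q` (≤ 1 Tamagawa-`3` carrier: multiplicative, additive `IV`/`IV*`, or none) and is, on the rows with ≥ 2
Tamagawa-`3` carriers, precisely the part of the refined Kolyvagin `≥`-half `M_∞ ≥ ord₃ ∏ c_ℓ` (p826193) that Jetchev's Thm. 1.4 does
not pay — the ONE remaining research statement of Σ, in Lean, ready to replace Σ in a v3 cut. Proof: case split on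
«∃ q ∣ N_E, s′ ≤ ord₃ c_q» — yes: `pDiv_of_dvd_level_of_heegnerFrame_of_prop52IrredP_of_namedFacts` (S2♭); no: Σ⁺. CONDITIONAL; closes
nothing by name. [cite: Jetchev2008, Thm. 1.4 (p. 812), Conj. 1.3] [cite: McCallumLMS1991, §5 Prop. 5.2 (p. 304)] [cite: GrossLMS1991, Prop. 3.7 (2), §6 p. 245] -/
theorem sigmaIrreducibleOptimalRows_of_increment_of_prop52IrredP_of_namedFacts
    (h52I : ∀ (W : WeierstrassCurve ℚ) [W.IsElliptic] [W.IsGloballyMinimal] [NeZero (W.conductorNorm ℤ)],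
        ¬ W.HasCM →
        ∀ (K : Type) [Field K] [NumberField K], IsImaginaryQuadratic K →
        NumberField.discr K ≠ -3 → NumberField.discr K ≠ -4 →
        SatisfiesHeegnerHypothesis (W.conductorNorm ℤ) K →
        ∀ (p : ℕ) [Fact p.Prime], p ≠ 2 → W.HasIrreducibleModPGaloisRep p → (p : ℤ) ∣ W.conductorNorm ℤ →
        ∀ (Dt : ModularParametrizationData W (W.conductorNorm ℤ)) (β : ℤ) (ι : K →+* ℂ)
          (d₁ : KolyvaginHeegnerData Dt β ι 1), ¬ IsOfFinAddOrder d₁.derivedPoint →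
        ∀ (r : ℕ), 0 < r →
        ∀ (Mr : ℕ),
          IsLeast {u : ℕ | ∃ (n : ℕ) (d : KolyvaginHeegnerData Dt β ι n), Squarefree n ∧
              n.primeFactors.card = r ∧
              (∀ ℓ ∈ n.primeFactors, Zhang2014.IsKolyvaginPrime (W.conductorNorm ℤ) W K p ℓ ∧
                u + 1 ≤ Zhang2014.kolyvaginIndex W p ℓ) ∧
              (∃ Q : (W.baseChange (ringClassField K ι n)).toAffine.Point,
                ((p ^ u : ℕ) : ℤ) • Q = d.derivedPoint) ∧
              ¬ ∃ Q : (W.baseChange (ringClassField K ι n)).toAffine.Point,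
                ((p ^ (u + 1) : ℕ) : ℤ) • Q = d.derivedPoint} Mr →
        ∀ (M : ℕ), Mr < M →
          ∃ (n : ℕ) (d : KolyvaginHeegnerData Dt β ι n), Squarefree n ∧ n.primeFactors.card = r ∧
            (∀ ℓ ∈ n.primeFactors, Zhang2014.IsKolyvaginPrime (W.conductorNorm ℤ) W K p ℓ ∧
              M ≤ Zhang2014.kolyvaginIndex W p ℓ) ∧
            addOrderOf (d.kolyvaginClass (Fact.out : p.Prime) M) = p ^ (M - Mr) ∧
            (∃ Q : (W.baseChange (ringClassField K ι n)).toAffine.Point,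
              ((p ^ Mr : ℕ) : ℤ) • Q = d.derivedPoint) ∧
            ¬ ∃ Q : (W.baseChange (ringClassField K ι n)).toAffine.Point,
              ((p ^ (Mr + 1) : ℕ) : ℤ) • Q = d.derivedPoint)
    (h37 : GrossLMS1991.prop37_2_frobeniusCongruence)
    (hPT : ∀ (K : Type) [Field K] [NumberField K], poitouTate_selmerStructure_duality_conj K)
    (hF1 : Gross1991_heegnerPoint_sub_ratTorsion_mem_E0_imageFree)
    (hIncr : ∀ (W : WeierstrassCurve ℚ) [W.IsElliptic] [W.IsGloballyMinimal] [NeZero (W.conductorNorm ℤ)]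
      (K : Type) [Field K] [NumberField K] (Dt : ModularParametrizationData W (W.conductorNorm ℤ))
      (H : HeegnerDatum (W.conductorNorm ℤ) (NumberField.discr K)) (ι : K →+* ℂ) (P : (W.baseChange K).toAffine.Point),
      ¬ W.HasCM → Addv W 3 → SubTprime W 3 → W.HasIrreducibleModPGaloisRep 3 → W.analyticRank = 1 →
      ¬ (3 : ℤ) ∣ Dt.c → IsImaginaryQuadratic K → SatisfiesHeegnerHypothesis (W.conductorNorm ℤ) K →
      (W.quadraticTwist (NumberField.discr K : ℚ)).entireLFunction 1 ≠ 0 →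
      WeierstrassCurve.Affine.Point.map ι.toRatAlgHom P = heegnerPointComplex Dt H → ¬ IsOfFinAddOrder P →
      Odd (NumberField.discr K) →
      ∀ (s' : ℕ), (∀ (q : ℕ) [Fact q.Prime], q ∣ W.conductorNorm ℤ →
          padicValNat 3 ((W.baseChange ℚ_[q]).localTamagawaNumber ℤ_[q]) < s') →
      s' ≤ padicValNat 3 W.tamagawaProduct →
      ∀ (n : ℕ) (d : KolyvaginHeegnerData Dt H.β ι n), Squarefree n →
      (∀ ℓ ∈ n.primeFactors, Zhang2014.IsKolyvaginPrime (W.conductorNorm ℤ) W K 3 ℓ ∧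
        s' ≤ Zhang2014.kolyvaginIndex W 3 ℓ) → Koly.PDiv d 3 s') :
    ∀ (W : WeierstrassCurve ℚ) [W.IsElliptic] [W.IsGloballyMinimal] [NeZero (W.conductorNorm ℤ)]
      (K : Type) [Field K] [NumberField K] (Dt : ModularParametrizationData W (W.conductorNorm ℤ))
      (H : HeegnerDatum (W.conductorNorm ℤ) (NumberField.discr K)) (ι : K →+* ℂ) (P : (W.baseChange K).toAffine.Point),
      ¬ W.HasCM → Addv W 3 → SubTprime W 3 → W.HasIrreducibleModPGaloisRep 3 → W.analyticRank = 1 →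
      ¬ (3 : ℤ) ∣ Dt.c → IsImaginaryQuadratic K → SatisfiesHeegnerHypothesis (W.conductorNorm ℤ) K →
      (W.quadraticTwist (NumberField.discr K : ℚ)).entireLFunction 1 ≠ 0 →
      WeierstrassCurve.Affine.Point.map ι.toRatAlgHom P = heegnerPointComplex Dt H → ¬ IsOfFinAddOrder P →
      Odd (NumberField.discr K) →
      ∀ (s' : ℕ), s' ≤ padicValNat 3 W.tamagawaProduct →
      ∀ (n : ℕ) (d : KolyvaginHeegnerData Dt H.β ι n), Squarefree n →
      (∀ ℓ ∈ n.primeFactors, Zhang2014.IsKolyvaginPrime (W.conductorNorm ℤ) W K 3 ℓ ∧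
        s' ≤ Zhang2014.kolyvaginIndex W 3 ℓ) → Koly.PDiv d 3 s' := by
  intro W _ _ _ K _ _ Dt H ι P hCM hadd hT hirr hr hc hK hHN hL hP hnt hodd s' hs' n d hn hℓ
  by_cases hq : ∃ (q : ℕ) (_ : Fact q.Prime), q ∣ W.conductorNorm ℤ ∧
      s' ≤ padicValNat 3 ((W.baseChange ℚ_[q]).localTamagawaNumber ℤ_[q])
  · obtain ⟨q, _, hqN, hsq⟩ := hq
    have h3N : 3 ∣ W.conductorNorm ℤ :=
      (W.dvd_conductorNorm_iff_not_hasGoodReductionAtPrime 3).mpr (not_good_of_addv W 3 hadd)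
    -- `d_K ∉ {-3, -4}`: `3 ∣ N_E` splits in `K`, `d_K` odd
    have h3 : NumberField.discr K ≠ -3 := by
      intro h
      exact (X11b.Three.not_dvd_discr_and_not_dvd_torsionOrder_of_heegner hK hHN (by decide) h3N).1
        (h ▸ ⟨-1, by norm_num⟩)
    have h4 : NumberField.discr K ≠ -4 := by
      intro h
      rw [h] at hodd
      exact (Int.not_odd_iff_even.mpr ⟨-2, by norm_num⟩) hodd
    exact pDiv_of_dvd_level_of_heegnerFrame_of_prop52IrredP_of_namedFacts h52I h37 hPT hF1 W hCM K hK h3 h4 hHN 3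
      (by decide) hirr h3N Dt H ι P hP hnt q hqN s' hsq n d hn hℓ
  · push Not at hq
    exact hIncr W K Dt H ι P hCM hadd hT hirr hr hc hK hHN hL hP hnt hodd s' (fun q hq' hqN ↦ hq q hq' hqN) hs' n d hn hℓ

/-! ## §2 Σ ⟺ Σ⁺ modulo the reading inputs -/

/-- **Σ ⟺ Σ⁺ given S2′ and the three named facts** — the registered research stub Σ = `stub_sigmaIrreducibleOptimalRows` (VERBATIM, left) is
EQUIVALENT to its increment Σ⁺ on the depths `m_max(E) < s′ ≤ ord₃ ∏_ℓ c_ℓ(E)` (right): (→) Σ⁺ is a special case of Σ; (←) §1. So a cut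
«Σ ↦ Σ⁺» loses and adds nothing modulo {S2′ of 20165, Gross 3.7 (2), Poitou–Tate, GZ86 III (3.1)}. CONDITIONAL; closes nothing by name.
[cite: Jetchev2008, Thm. 1.4 (p. 812), Conj. 1.3] [cite: McCallumLMS1991, §5 Prop. 5.2 (p. 304)] -/
theorem sigmaIrreducibleOptimalRows_iff_increment_of_prop52IrredP_of_namedFacts
    (h52I : ∀ (W : WeierstrassCurve ℚ) [W.IsElliptic] [W.IsGloballyMinimal] [NeZero (W.conductorNorm ℤ)],
        ¬ W.HasCM →
        ∀ (K : Type) [Field K] [NumberField K], IsImaginaryQuadratic K →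
        NumberField.discr K ≠ -3 → NumberField.discr K ≠ -4 →
        SatisfiesHeegnerHypothesis (W.conductorNorm ℤ) K →
        ∀ (p : ℕ) [Fact p.Prime], p ≠ 2 → W.HasIrreducibleModPGaloisRep p → (p : ℤ) ∣ W.conductorNorm ℤ →
        ∀ (Dt : ModularParametrizationData W (W.conductorNorm ℤ)) (β : ℤ) (ι : K →+* ℂ)
          (d₁ : KolyvaginHeegnerData Dt β ι 1), ¬ IsOfFinAddOrder d₁.derivedPoint →
        ∀ (r : ℕ), 0 < r →
        ∀ (Mr : ℕ),
          IsLeast {u : ℕ | ∃ (n : ℕ) (d : KolyvaginHeegnerData Dt β ι n), Squarefree n ∧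
              n.primeFactors.card = r ∧
              (∀ ℓ ∈ n.primeFactors, Zhang2014.IsKolyvaginPrime (W.conductorNorm ℤ) W K p ℓ ∧
                u + 1 ≤ Zhang2014.kolyvaginIndex W p ℓ) ∧
              (∃ Q : (W.baseChange (ringClassField K ι n)).toAffine.Point,
                ((p ^ u : ℕ) : ℤ) • Q = d.derivedPoint) ∧
              ¬ ∃ Q : (W.baseChange (ringClassField K ι n)).toAffine.Point,
                ((p ^ (u + 1) : ℕ) : ℤ) • Q = d.derivedPoint} Mr →
        ∀ (M : ℕ), Mr < M →
          ∃ (n : ℕ) (d : KolyvaginHeegnerData Dt β ι n), Squarefree n ∧ n.primeFactors.card = r ∧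
            (∀ ℓ ∈ n.primeFactors, Zhang2014.IsKolyvaginPrime (W.conductorNorm ℤ) W K p ℓ ∧
              M ≤ Zhang2014.kolyvaginIndex W p ℓ) ∧
            addOrderOf (d.kolyvaginClass (Fact.out : p.Prime) M) = p ^ (M - Mr) ∧
            (∃ Q : (W.baseChange (ringClassField K ι n)).toAffine.Point,
              ((p ^ Mr : ℕ) : ℤ) • Q = d.derivedPoint) ∧
            ¬ ∃ Q : (W.baseChange (ringClassField K ι n)).toAffine.Point,
              ((p ^ (Mr + 1) : ℕ) : ℤ) • Q = d.derivedPoint)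
    (h37 : GrossLMS1991.prop37_2_frobeniusCongruence)
    (hPT : ∀ (K : Type) [Field K] [NumberField K], poitouTate_selmerStructure_duality_conj K)
    (hF1 : Gross1991_heegnerPoint_sub_ratTorsion_mem_E0_imageFree) :
    (∀ (W : WeierstrassCurve ℚ) [W.IsElliptic] [W.IsGloballyMinimal] [NeZero (W.conductorNorm ℤ)]
      (K : Type) [Field K] [NumberField K] (Dt : ModularParametrizationData W (W.conductorNorm ℤ))
      (H : HeegnerDatum (W.conductorNorm ℤ) (NumberField.discr K)) (ι : K →+* ℂ) (P : (W.baseChange K).toAffine.Point),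
      ¬ W.HasCM → Addv W 3 → SubTprime W 3 → W.HasIrreducibleModPGaloisRep 3 → W.analyticRank = 1 →
      ¬ (3 : ℤ) ∣ Dt.c → IsImaginaryQuadratic K → SatisfiesHeegnerHypothesis (W.conductorNorm ℤ) K →
      (W.quadraticTwist (NumberField.discr K : ℚ)).entireLFunction 1 ≠ 0 →
      WeierstrassCurve.Affine.Point.map ι.toRatAlgHom P = heegnerPointComplex Dt H → ¬ IsOfFinAddOrder P →
      Odd (NumberField.discr K) →
      ∀ (s' : ℕ), s' ≤ padicValNat 3 W.tamagawaProduct →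
      ∀ (n : ℕ) (d : KolyvaginHeegnerData Dt H.β ι n), Squarefree n →
      (∀ ℓ ∈ n.primeFactors, Zhang2014.IsKolyvaginPrime (W.conductorNorm ℤ) W K 3 ℓ ∧
        s' ≤ Zhang2014.kolyvaginIndex W 3 ℓ) → Koly.PDiv d 3 s') ↔
    (∀ (W : WeierstrassCurve ℚ) [W.IsElliptic] [W.IsGloballyMinimal] [NeZero (W.conductorNorm ℤ)]
      (K : Type) [Field K] [NumberField K] (Dt : ModularParametrizationData W (W.conductorNorm ℤ))
      (H : HeegnerDatum (W.conductorNorm ℤ) (NumberField.discr K)) (ι : K →+* ℂ) (P : (W.baseChange K).toAffine.Point),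
      ¬ W.HasCM → Addv W 3 → SubTprime W 3 → W.HasIrreducibleModPGaloisRep 3 → W.analyticRank = 1 →
      ¬ (3 : ℤ) ∣ Dt.c → IsImaginaryQuadratic K → SatisfiesHeegnerHypothesis (W.conductorNorm ℤ) K →
      (W.quadraticTwist (NumberField.discr K : ℚ)).entireLFunction 1 ≠ 0 →
      WeierstrassCurve.Affine.Point.map ι.toRatAlgHom P = heegnerPointComplex Dt H → ¬ IsOfFinAddOrder P →
      Odd (NumberField.discr K) →
      ∀ (s' : ℕ), (∀ (q : ℕ) [Fact q.Prime], q ∣ W.conductorNorm ℤ →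
          padicValNat 3 ((W.baseChange ℚ_[q]).localTamagawaNumber ℤ_[q]) < s') →
      s' ≤ padicValNat 3 W.tamagawaProduct →
      ∀ (n : ℕ) (d : KolyvaginHeegnerData Dt H.β ι n), Squarefree n →
      (∀ ℓ ∈ n.primeFactors, Zhang2014.IsKolyvaginPrime (W.conductorNorm ℤ) W K 3 ℓ ∧
        s' ≤ Zhang2014.kolyvaginIndex W 3 ℓ) → Koly.PDiv d 3 s') :=
  ⟨fun hS W _ _ _ K _ _ Dt H ι P hCM hadd hT hirr hr hc hK hHN hL hP hnt hodd s' _ hs' n d hn hℓ ↦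
      hS W K Dt H ι P hCM hadd hT hirr hr hc hK hHN hL hP hnt hodd s' hs' n d hn hℓ,
    fun hIncr ↦ sigmaIrreducibleOptimalRows_of_increment_of_prop52IrredP_of_namedFacts h52I h37 hPT hF1 hIncr⟩

/-! ## §3 The ONTO rows: Σ ⟸ three PRINT facts + Σ⁺ (no reading stub) -/

/-- **On the rows with `ρ̄_{E,3}` ONTO, Σ's only non-print content is the increment Σ⁺.** Σ's binders VERBATIM + «`ρ̄₃` onto» (v1's r₁
binder) ⟹ Σ's conclusion, from the three PRINT facts `hPT` (Poitou–Tate), `hE0` (Gross 1991 §6 / [GZ86 III (3.1)],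
`Gross1991_heegnerPoint_sub_ratTorsion_mem_E0`), `h372` (Gross 1991 Prop. 3.7 (2)) and the displayed onto-increment `hIncr` (Σ's binders + onto
+ «every prime `q ∣ N_E` has `ord₃ c_q < s′`»). Per depth: `s′ ≤ ord₃ c_q` for some `q ∣ N_E` ⟹ the print-only swap end form
(`pDiv_of_dvd_level_of_heegnerFrame_onto_of_threePrintFacts`, p827485; `q = 3` has `c₃ = 2` on (t′), depth `0`); else Σ⁺. So v1's r₁
(`stub_ontoRowsOfManinUnit`) ⟸ PUB + three print facts + L₀ + Σ⁺-onto — NO reading stub. CONDITIONAL; closes nothing by name.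
[cite: Jetchev2008, Thm. 1.4 (p. 812), Conj. 1.3] [cite: GrossLMS1991, Prop. 3.7 (2), §6 p. 245] [cite: Cha2005, Thm. 3, Thm. 7] -/
theorem sigmaOntoRows_of_increment_of_threePrintFacts
    (hPT : ∀ (K : Type) [Field K] [NumberField K], poitouTate_selmerStructure_duality_conj K)
    (hE0 : Gross1991_heegnerPoint_sub_ratTorsion_mem_E0) (h372 : GrossLMS1991.prop37_2_frobeniusCongruence)
    (hIncr : ∀ (W : WeierstrassCurve ℚ) [W.IsElliptic] [W.IsGloballyMinimal] [NeZero (W.conductorNorm ℤ)]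
      (K : Type) [Field K] [NumberField K] (Dt : ModularParametrizationData W (W.conductorNorm ℤ))
      (H : HeegnerDatum (W.conductorNorm ℤ) (NumberField.discr K)) (ι : K →+* ℂ) (P : (W.baseChange K).toAffine.Point),
      ¬ W.HasCM → Addv W 3 → SubTprime W 3 → W.HasIrreducibleModPGaloisRep 3 → W.HasSurjectiveModNGaloisRep 3 →
      W.analyticRank = 1 →
      ¬ (3 : ℤ) ∣ Dt.c → IsImaginaryQuadratic K → SatisfiesHeegnerHypothesis (W.conductorNorm ℤ) K →
      (W.quadraticTwist (NumberField.discr K : ℚ)).entireLFunction 1 ≠ 0 →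
      WeierstrassCurve.Affine.Point.map ι.toRatAlgHom P = heegnerPointComplex Dt H → ¬ IsOfFinAddOrder P →
      Odd (NumberField.discr K) →
      ∀ (s' : ℕ), (∀ (q : ℕ) [Fact q.Prime], q ∣ W.conductorNorm ℤ →
          padicValNat 3 ((W.baseChange ℚ_[q]).localTamagawaNumber ℤ_[q]) < s') →
      s' ≤ padicValNat 3 W.tamagawaProduct →
      ∀ (n : ℕ) (d : KolyvaginHeegnerData Dt H.β ι n), Squarefree n →
      (∀ ℓ ∈ n.primeFactors, Zhang2014.IsKolyvaginPrime (W.conductorNorm ℤ) W K 3 ℓ ∧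
        s' ≤ Zhang2014.kolyvaginIndex W 3 ℓ) → Koly.PDiv d 3 s') :
    ∀ (W : WeierstrassCurve ℚ) [W.IsElliptic] [W.IsGloballyMinimal] [NeZero (W.conductorNorm ℤ)]
      (K : Type) [Field K] [NumberField K] (Dt : ModularParametrizationData W (W.conductorNorm ℤ))
      (H : HeegnerDatum (W.conductorNorm ℤ) (NumberField.discr K)) (ι : K →+* ℂ) (P : (W.baseChange K).toAffine.Point),
      ¬ W.HasCM → Addv W 3 → SubTprime W 3 → W.HasIrreducibleModPGaloisRep 3 → W.HasSurjectiveModNGaloisRep 3 →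
      W.analyticRank = 1 →
      ¬ (3 : ℤ) ∣ Dt.c → IsImaginaryQuadratic K → SatisfiesHeegnerHypothesis (W.conductorNorm ℤ) K →
      (W.quadraticTwist (NumberField.discr K : ℚ)).entireLFunction 1 ≠ 0 →
      WeierstrassCurve.Affine.Point.map ι.toRatAlgHom P = heegnerPointComplex Dt H → ¬ IsOfFinAddOrder P →
      Odd (NumberField.discr K) →
      ∀ (s' : ℕ), s' ≤ padicValNat 3 W.tamagawaProduct →
      ∀ (n : ℕ) (d : KolyvaginHeegnerData Dt H.β ι n), Squarefree n →
      (∀ ℓ ∈ n.primeFactors, Zhang2014.IsKolyvaginPrime (W.conductorNorm ℤ) W K 3 ℓ ∧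
        s' ≤ Zhang2014.kolyvaginIndex W 3 ℓ) → Koly.PDiv d 3 s' := by
  intro W _ _ _ K _ _ Dt H ι P hCM hadd hT hirr hsurj hr hc hK hHN hL hP hnt hodd s' hs' n d hn hℓ
  haveI : Fact (Nat.Prime 3) := ⟨Nat.prime_three⟩
  by_cases hq : ∃ (q : ℕ) (_ : Fact q.Prime), q ∣ W.conductorNorm ℤ ∧
      s' ≤ padicValNat 3 ((W.baseChange ℚ_[q]).localTamagawaNumber ℤ_[q])
  · obtain ⟨q, _, hqN, hsq⟩ := hq
    by_cases hq3 : q = 3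
    · -- the carrier is `3` itself: `c₃(E) = 2` on a (t′) row, so the depth is `0`
      subst hq3
      have h0 : padicValNat 3 ((W.baseChange ℚ_[3]).localTamagawaNumber ℤ_[3]) = 0 := by
        rw [localTamagawaNumber_three_eq_two_of_subTprime W hadd hT]
        exact padicValNat.eq_zero_of_not_dvd (by norm_num)
      have hs0 : s' = 0 := by omega
      subst hs0
      exact Koly.pDiv_zero d 3
    · have h3N : 3 ∣ W.conductorNorm ℤ :=
        (W.dvd_conductorNorm_iff_not_hasGoodReductionAtPrime 3).mpr (not_good_of_addv W 3 hadd)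
      -- `d_K ∉ {-3, -4}`: `3 ∣ N_E` splits in `K`, `d_K` odd
      have h3 : NumberField.discr K ≠ -3 := by
        intro h
        exact (X11b.Three.not_dvd_discr_and_not_dvd_torsionOrder_of_heegner hK hHN (by decide) h3N).1
          (h ▸ ⟨-1, by norm_num⟩)
      have h4 : NumberField.discr K ≠ -4 := by
        intro h
        rw [h] at hodd
        exact (Int.not_odd_iff_even.mpr ⟨-2, by norm_num⟩) hodd
      exact pDiv_of_dvd_level_of_heegnerFrame_onto_of_threePrintFacts hPT hE0 h372 W K hK h3 h4 hHN 3 (by decide) hsurj Dt H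
        ι P hP hnt q hqN hq3 s' hsq n d hn hℓ
  · push Not at hq
    exact hIncr W K Dt H ι P hCM hadd hT hirr hsurj hr hc hK hHN hL hP hnt hodd s' (fun q hq' hqN ↦ hq q hq' hqN) hs' n d
      hn hℓ

end Summit.BirchSwinnertonDyer.BirchSwinnertonDyer.Theorems.TprimeHeegnerUpperOfManinUnit

end
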